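import Mathlib
import Summits.Ventures.PercRepro2.CrossAPrimeVMarkedThreeRouteConn

/-!
# Three coins: the cylinder decomposition and the product law
(blind cell PercRepro2, p5 g41; S4 §2.4 (s) addendum 61 — part 2 of `CrossAPrimeVMarkedThreeRoute`)

`prob_eq_sum_coins`: a probability is the sum of its eight cylinder parts over three edges;
`prob_triple`: a cylinder event (determined edge by edge) is independent of an event determined by
the other edges, and the three coins are independent.  Own work; standard axioms.
-/

namespace Summit.Ventures.PercRepro2

namespace CrossAPrimeVMarkedThreeRoute

variable {V : Type*} {E : Type*} [Fintype E] [DecidableEq E] [Fintype V] [DecidableEq V]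
  {R : Type*} [Field R] [LinearOrder R] [IsStrictOrderedRing R]

section Coins

variable {fa fo fb : E}

omit [Fintype V] [DecidableEq V] [LinearOrder R] [IsStrictOrderedRing R] in
/-- A probability is the sum over the eight cylinders of three edges. -/
lemma prob_eq_sum_coins (p : E → R) (X : Set (Config E)) (fa fo fb : E) :
    prob p X =
      prob p (X ∩ openEdge fa ∩ openEdge fo ∩ openEdge fb) +
        prob p (X ∩ openEdge fa ∩ openEdge fo ∩ (openEdge fb)ᶜ) +
        prob p (X ∩ openEdge fa ∩ (openEdge fo)ᶜ ∩ openEdge fb) +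
        prob p (X ∩ openEdge fa ∩ (openEdge fo)ᶜ ∩ (openEdge fb)ᶜ) +
        prob p (X ∩ (openEdge fa)ᶜ ∩ openEdge fo ∩ openEdge fb) +
        prob p (X ∩ (openEdge fa)ᶜ ∩ openEdge fo ∩ (openEdge fb)ᶜ) +
        prob p (X ∩ (openEdge fa)ᶜ ∩ (openEdge fo)ᶜ ∩ openEdge fb) +
        prob p (X ∩ (openEdge fa)ᶜ ∩ (openEdge fo)ᶜ ∩ (openEdge fb)ᶜ) := by
  have h1 := prob_inter_add_prob_inter_compl p X (openEdge fa)
  have h2 := prob_inter_add_prob_inter_compl p (X ∩ openEdge fa) (openEdge fo)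
  have h3 := prob_inter_add_prob_inter_compl p (X ∩ (openEdge fa)ᶜ) (openEdge fo)
  have h4 := prob_inter_add_prob_inter_compl p (X ∩ openEdge fa ∩ openEdge fo) (openEdge fb)
  have h5 := prob_inter_add_prob_inter_compl p (X ∩ openEdge fa ∩ (openEdge fo)ᶜ) (openEdge fb)
  have h6 := prob_inter_add_prob_inter_compl p (X ∩ (openEdge fa)ᶜ ∩ openEdge fo) (openEdge fb)
  have h7 := prob_inter_add_prob_inter_compl p (X ∩ (openEdge fa)ᶜ ∩ (openEdge fo)ᶜ) (openEdge fb)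
  linear_combination -h1 - h2 - h3 - h4 - h5 - h6 - h7

omit [Fintype E] [DecidableEq E] [Fintype V] [DecidableEq V] in
/-- Two events determined by the same edge set: their intersection is. -/
lemma dependsOn_inter3 {A B : Set (Config E)} {S : Set E} (hA : DependsOn (· ∈ A) S)
    (hB : DependsOn (· ∈ B) S) : DependsOn (· ∈ A ∩ B) S := by
  have := dependsOn_inter hA hB
  rwa [Set.union_self] at this

omit [Fintype E] [DecidableEq E] [Fintype V] [DecidableEq V] in
/-- Two events determined by the same edge set: their union is. -/
lemma dependsOn_union3 {A B : Set (Config E)} {S : Set E} (hA : DependsOn (· ∈ A) S)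
    (hB : DependsOn (· ∈ B) S) : DependsOn (· ∈ A ∪ B) S := by
  have := dependsOn_union hA hB
  rwa [Set.union_self] at this

omit [Fintype V] [DecidableEq V] [LinearOrder R] [IsStrictOrderedRing R] in
/-- **The product law for three coins and a far event**: `P(A₁ ∩ A₂ ∩ A₃ ∩ X) = P(A₁)P(A₂)P(A₃)P(X)`
when `Aᵢ` is determined by the edge `fᵢ` and `X` by the other edges. -/
lemma prob_triple (p : E → R) (hao : fa ≠ fo) (hab : fa ≠ fb) (hob : fo ≠ fb)
    {A₁ A₂ A₃ X : Set (Config E)} (h1 : DependsOn (· ∈ A₁) ({fa} : Set E))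
    (h2 : DependsOn (· ∈ A₂) ({fo} : Set E)) (h3 : DependsOn (· ∈ A₃) ({fb} : Set E))
    (hX : DependsOn (· ∈ X) (({fa, fo, fb} : Set E)ᶜ)) :
    prob p (A₁ ∩ A₂ ∩ A₃ ∩ X) = prob p A₁ * prob p A₂ * prob p A₃ * prob p X := by
  have d12 : DependsOn (· ∈ A₁ ∩ A₂) ({fa, fo} : Set E) := by
    have := dependsOn_inter h1 h2
    rwa [Set.singleton_union] at this
  have d123 : DependsOn (· ∈ A₁ ∩ A₂ ∩ A₃) ({fa, fo, fb} : Set E) := by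
    have := dependsOn_inter d12 h3
    refine this.mono ?_
    intro e he
    simp only [Set.mem_union, Set.mem_insert_iff, Set.mem_singleton_iff] at he ⊢
    tauto
  have dis12 : Disjoint ({fa, fo} : Set E) {fb} := by
    rw [Set.disjoint_singleton_right]
    simp [hab.symm, hob.symm]
  rw [prob_inter_eq_mul_of_dependsOn p disjoint_compl_right d123 hX,
    prob_inter_eq_mul_of_dependsOn p dis12 d12 h3,
    prob_inter_eq_mul_of_dependsOn p (Set.disjoint_singleton.2 hao) h1 h2]

end Coins

end CrossAPrimeVMarkedThreeRoute

end Summit.Ventures.PercRepro2
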